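import Summits.BirchSwinnertonDyer.BirchSwinnertonDyer.Theses.KatoDescentPotSupersingular
import Summits.BirchSwinnertonDyer.Rank1Residual.Additive.KatoDescentIrreducibleReadings
import Summits.BirchSwinnertonDyer.Rank1Residual.Additive.KatoDescentTorsionFree
import Summits.BirchSwinnertonDyer.Rank1Residual.O6.X3KatoMemberBound
import HarnessLib

/-!
# Route `KatoDescentPotSupersingular` (rung K9, cell `bsd-potss`): the crux `WildUpperNonsurjTower`
# (U₀-ns, item stmt-BirchSwinnertonDyer-19189) REDUCES TO ONE NAMED QUANTITY — the `μ`-invariant of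
# Kato's `𝐇²(T₃E)⁰` — over printed, image-free readings (a `--supports` file; the item is NOT closed)

The rows of the crux: `E/ℚ` globally minimal, wild additive potentially supersingular at `3` (`ClassO6 W 3`),
analytic rank `0`, `E[3]` IRREDUCIBLE, `3`-adic tower image NOT surjective (mod-`3` image the normaliser
of a Cartan subgroup, or surjective mod `3` but not mod `9` — Elkies' curves, all additive potentially
good at `3` by Wuthrich 2014 Lemma 20). On these rows Kato's Thm. 12.5 (4) / 14.5 (3) do not apply
(their proof runs through Thm. 13.4 (3), whose `σ` with `Coker(1 − σ)` free of rank one would force the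
mod-`9` image to contain `SL₂(ℤ/9)`, i.e. (12.5.2)), and no Euler-system or Kolyvagin-system bound in print is
integral there. What Kato DOES print image-free — Thm. 12.4 (3) (`𝐇¹(T)` free for `T/𝔪T` irreducible,
`p ≠ 2`), Thm. 12.5 (3) (the divisibility at every height-one prime NOT containing `p`), Thm. 12.6 +
13.14 (integrality of the zeta element once `𝐇¹(T)` is free and the stable lattices are homothetic —
tree theorem `Kato2004.exists_eq_pow_smul_of_galoisStable_of_hasIrreducibleModPGaloisRep`), Thm. 14.5
(1)–(2), §14.14–14.16 (the rank-`0` count) — gives, by the module theory of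
`Kato2004/ZetaIndexMuDefectSkeletonProofs.lean` and the descent of
`Additive/KatoDescentIrreducibleReadings.lean` (this seat), **`ord₃ #Ш(E) ≤ ord₃ #Ш_an(E) + μ(𝐇²(T₃E)⁰)`
on EVERY irreducible wild rank-`0` row** (first theorem below): the "uncontrolled power of `3`" of the
item's why-it-might-fail is exactly `3^{μ(𝐇²(T)⁰)}`. Hence the crux FOLLOWS from the single statement
"`μ(𝐇²(T₃E)⁰) = 0` on its rows" (`Irreducible.H2MuZero`; = Coates–Sujatha's Conjecture A for `(E, 3)` up
to finitely generated local terms; printed only when `E` has a rational `3`-isogeny — Wuthrich 2014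
Lemma 14 — which these rows exclude) over the displayed readings, GZK and modularity (second theorem);
and, alternatively, from Kato's Main Conjecture 12.10 for `T₃E` at the rows themselves (`3 ∤ #E(ℚ)_tors`
by irreducibility, so the kmc seat's torsion-free descent applies with no isogeny; third theorem).
CONDITIONAL over displayed hypotheses (`proof.conditional`); nothing about Kato's objects, Conjecture A
or KMC is asserted; the item is NOT closed. Seat `bsd-potss-k9-c4`.

References: [Kato2004Asterisque] Thm. 12.4 (3) (p. 221), Thm. 12.5 (3)–(4), (12.5.2) (p. 222), Thm. 12.6
(p. 222), Thm. 13.4 (3) (p. 226), 13.14 (p. 234), Thm. 14.5 (1)–(3) (p. 236), §14.14 and Lemma 14.15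
(pp. 243–244), Prop. 14.16 (2) (p. 244), Conj. 12.10 (p. 224); [CoatesSujatha2005] Conj. A, Thm. 3.4;
[Wuthrich2014] Lemma 14 (p. 396), Lemma 20 (p. 399); [Washington1997] §13.2.
-/

set_option autoImplicit false
-- sibling precedent (`KatoDescentPotSupersingularAssembly.lean`): the directory name repeats the summit name
set_option linter.dupNamespace false

noncomputable section

open scoped Classical

namespace Summit.BirchSwinnertonDyer.BirchSwinnertonDyer.Theorems

open WeierstrassCurve Literature.NumberTheory.EllipticCurves
  Literature.NumberTheory.EllipticCurves.Rank1Residual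
  Literature.NumberTheory.EllipticCurves.Rank1Residual.Typed
  Summit.BirchSwinnertonDyer.Rank1Residual.Additive
  Summit.BirchSwinnertonDyer.Rank1Residual
  Summit.BirchSwinnertonDyer.BirchSwinnertonDyer.Theses.KatoDescentPotSupersingular

variable {IsOf : ∀ (W : WeierstrassCurve ℚ) [W.IsElliptic] [W.IsGloballyMinimal] (p : ℕ) [Fact p.Prime],
  KatoDescentDatum p → Prop}
variable {KMC : ∀ (W : WeierstrassCurve ℚ) [W.IsElliptic] [W.IsGloballyMinimal] (p : ℕ), Prop}

/-- **Kato's bound WITH THE `μ`-DEFECT on every IRREDUCIBLE wild rank-`0` row (tower surjective or not):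
`ord₃ #Ш(E) ≤ ord₃ #Ш_an(E) + μ(𝐇²(T₃E)⁰)`** on any realised Kato descent datum — over the image-free
readings I2 (Thm. 12.5 (3)), I4 (Thm. 14.5 (1)–(2)), the kmc seat's count 1♭ (Prop. 14.16 (2) etc.),
GZK and modularity (`Irreducible.exists_shaAn_le_add_muInvariant` at `p = 3`; `ClassO6` supplies
additivity and `0 ≤ ord₃ j`). The defect is the ONE named quantity the crux `WildUpperNonsurjTower`
hinges on. [cite: Kato2004Asterisque, Thm. 12.5 (3) (p. 222), Thm. 14.5 (1)–(3) (p. 236), §14.14 and Lemma 14.15 (pp. 243–244), Prop. 14.16 (2) (p. 244)]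
[cite: Washington1997, §13.2] -/
theorem wildUpper_irreducible_shaAn_le_add_muInvariant (hR : TorsionFree.DescentCountReading IsOf)
    (hdiv : Irreducible.DivisibilityOffP IsOf) (hz : Irreducible.ZetaIndexNeZero IsOf)
    (hGZK : rank_eq_analyticRank_of_analyticRank_le_one) (hmod : hasEntireLFunction_rat)
    (W : WeierstrassCurve ℚ) [W.IsElliptic] [W.IsGloballyMinimal] [Fact (3 : ℕ).Prime]
    (hr : W.analyticRank = 0) (hO : ClassO6 W 3) (hI : W.HasIrreducibleModPGaloisRep 3)
    (D : KatoDescentDatum 3) (hDof : IsOf W 3 D) :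
    ∃ q : ℚ, shaAn W = (q : ℂ) ∧ (padicValNat 3 W.shaOrder : ℤ) ≤ padicValRat 3 q + muInvariant 3 D.H2 :=
  Irreducible.exists_shaAn_le_add_muInvariant W 3 hR hdiv hz hGZK hmod hr (by decide) hO.2.1
    hO.padicValRat_j_nonneg hI D hDof

/-- **PARITY SHARPENING: a defect `μ(𝐇²(T₃E)⁰) ≤ 1` is already harmless when `ord₃ #Ш_an(E)` is even.**
On an irreducible wild rank-`0` row with a realised datum of `μ`-invariant `≤ 1` and `ord₃ #Ш_an` even (a
per-curve decidable modular-symbol certificate, the reducible rows' `stub_red_oddSha`-type input; NOT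
asserted), `ord₃ #Ш ≤ ord₃ #Ш_an + 1` with both sides even (`#Ш` is a square: Cassels–Tate, named fact
`exists_casselsTate_pairing` via `isSquare_shaOrder_of_casselsTate`) gives the upper half. So only rows with
`μ(𝐇²(T₃E)⁰) ≥ 2` (or odd `ord₃ #Ш_an`) can defeat the crux. [cite: Kato2004Asterisque, Thm. 12.5 (3) (p. 222), Thm. 14.5 (1)–(3) (p. 236)]
[cite: SilvermanAEC2009, Thm. X.4.14] [cite: Washington1997, §13.2] -/
theorem missingUpperBoundAt_wild_irreducible_of_muInvariant_le_one_of_even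
    (hR : TorsionFree.DescentCountReading IsOf)
    (hdiv : Irreducible.DivisibilityOffP IsOf) (hz : Irreducible.ZetaIndexNeZero IsOf)
    (hCT : exists_casselsTate_pairing (K := ℚ))
    (hGZK : rank_eq_analyticRank_of_analyticRank_le_one) (hmod : hasEntireLFunction_rat)
    (W : WeierstrassCurve ℚ) [W.IsElliptic] [W.IsGloballyMinimal] [Fact (3 : ℕ).Prime]
    (hr : W.analyticRank = 0) (hO : ClassO6 W 3) (hI : W.HasIrreducibleModPGaloisRep 3)
    (D : KatoDescentDatum 3) (hDof : IsOf W 3 D) (hμ : muInvariant 3 D.H2 ≤ 1)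
    (heven : ∀ q : ℚ, shaAn W = (q : ℂ) → Even (padicValRat 3 q)) : MissingUpperBoundAt W 3 := by
  obtain ⟨q, hq, hle⟩ :=
    wildUpper_irreducible_shaAn_le_add_muInvariant hR hdiv hz hGZK hmod W hr hO hI D hDof
  have hfin : W.ShaFinite := (hGZK W (by rw [hr]; exact zero_le_one)).2
  have hsq : IsSquare W.shaOrder := isSquare_shaOrder_of_casselsTate hCT W hfin
  obtain ⟨a, ha⟩ := O6.even_padicValNat_of_isSquare (p := 3) hsq (W.shaOrder_pos hfin).ne'
  obtain ⟨b, hb⟩ := heven q hq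
  refine ⟨q, hq, ?_⟩
  have hμ' : (muInvariant 3 D.H2 : ℤ) ≤ 1 := by exact_mod_cast hμ
  have ha' : ((padicValNat 3 W.shaOrder : ℕ) : ℤ) = (a : ℤ) + (a : ℤ) := by exact_mod_cast ha
  omega

/-- **The crux `WildUpperNonsurjTower` from the WEAKER defect bound `μ(𝐇²(T₃E)⁰) ≤ 1` plus even
`ord₃ #Ш_an` on its rows** (readings I2–I4, count 1♭, Cassels–Tate, GZK, modularity): the parity sharpening
run row by row, a datum existing by Reading I3. Conditional over displayed hypotheses; nothing asserted; the
item is not closed. [cite: Kato2004Asterisque, Thm. 12.5 (3) (p. 222), Thm. 14.5 (1)–(3) (p. 236)]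
[cite: SilvermanAEC2009, Thm. X.4.14] -/
theorem wildUpperNonsurjTower_of_muInvariant_le_one_of_even (hR : TorsionFree.DescentCountReading IsOf)
    (hdiv : Irreducible.DivisibilityOffP IsOf) (hz : Irreducible.ZetaIndexNeZero IsOf)
    (hreal : Irreducible.Realizable IsOf) (hCT : exists_casselsTate_pairing (K := ℚ))
    (hGZK : rank_eq_analyticRank_of_analyticRank_le_one) (hmod : hasEntireLFunction_rat)
    (hμ : ∀ (W : WeierstrassCurve ℚ) [W.IsElliptic] [W.IsGloballyMinimal] [Fact (3 : ℕ).Prime],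
      W.analyticRank = 0 → ClassO6 W 3 → W.HasIrreducibleModPGaloisRep 3 →
      ¬ (∀ n : ℕ, W.HasSurjectiveModNGaloisRep (3 ^ n : ℕ)) →
      ∀ D : KatoDescentDatum 3, IsOf W 3 D → muInvariant 3 D.H2 ≤ 1)
    (heven : ∀ (W : WeierstrassCurve ℚ) [W.IsElliptic] [W.IsGloballyMinimal] [Fact (3 : ℕ).Prime],
      W.analyticRank = 0 → ClassO6 W 3 → W.HasIrreducibleModPGaloisRep 3 →
      ¬ (∀ n : ℕ, W.HasSurjectiveModNGaloisRep (3 ^ n : ℕ)) →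
      ∀ q : ℚ, shaAn W = (q : ℂ) → Even (padicValRat 3 q)) :
    Summit.BirchSwinnertonDyer.BirchSwinnertonDyer.Theses.KatoDescentPotSupersingular.WildUpperNonsurjTower := by
  intro W _ _ _ hr hO hI hns
  obtain ⟨D, hDof⟩ := hreal W 3 (by decide) hO.2.1 hO.padicValRat_j_nonneg hI
  exact missingUpperBoundAt_wild_irreducible_of_muInvariant_le_one_of_even hR hdiv hz hCT hGZK hmod W hr
    hO hI D hDof (hμ W hr hO hI hns D hDof) (heven W hr hO hI hns)

/-- **The crux `WildUpperNonsurjTower` FOLLOWS FROM `μ(𝐇²(T₃E)⁰) = 0` ON ITS ROWS** — over the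
image-free readings I2–I4 (Thm. 12.5 (3); 12.4 (3) + 12.6 + 13.14; 14.5 (1)–(2)), the count 1♭, GZK,
modularity: for `W` wild of analytic rank `0` with `E[3]` irreducible and non-surjective `3`-adic tower,
`μ = 0` on the realised data (`Irreducible.H2MuZero IsOf W 3`, asked ONLY on the rows of the item)
gives `MissingUpperBoundAt W 3` by `Irreducible.missingUpperBoundAt_of_h2MuZero`. Conditional over
displayed hypotheses (Coates–Sujatha Conjecture A on these rows is NOT asserted); the item is not closed.
[cite: Kato2004Asterisque, Thm. 12.5 (3) (p. 222), Thm. 14.5 (1)–(3) (p. 236), Prop. 14.16 (2) (p. 244)]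
[cite: CoatesSujatha2005, Conjecture A] -/
theorem wildUpperNonsurjTower_of_h2MuZero (hR : TorsionFree.DescentCountReading IsOf)
    (hdiv : Irreducible.DivisibilityOffP IsOf) (hz : Irreducible.ZetaIndexNeZero IsOf)
    (hreal : Irreducible.Realizable IsOf)
    (hGZK : rank_eq_analyticRank_of_analyticRank_le_one) (hmod : hasEntireLFunction_rat)
    (hμ : ∀ (W : WeierstrassCurve ℚ) [W.IsElliptic] [W.IsGloballyMinimal] [Fact (3 : ℕ).Prime],
      W.analyticRank = 0 → ClassO6 W 3 → W.HasIrreducibleModPGaloisRep 3 →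
      ¬ (∀ n : ℕ, W.HasSurjectiveModNGaloisRep (3 ^ n : ℕ)) → Irreducible.H2MuZero IsOf W 3) :
    Summit.BirchSwinnertonDyer.BirchSwinnertonDyer.Theses.KatoDescentPotSupersingular.WildUpperNonsurjTower := by
  intro W _ _ _ hr hO hI hns
  obtain ⟨D, hDof⟩ := hreal W 3 (by decide) hO.2.1 hO.padicValRat_j_nonneg hI
  obtain ⟨q, hq, hle⟩ :=
    wildUpper_irreducible_shaAn_le_add_muInvariant hR hdiv hz hGZK hmod W hr hO hI D hDof
  refine ⟨q, hq, ?_⟩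
  rw [hμ W hr hO hI hns D hDof] at hle
  simpa using hle

/-- **The crux `WildUpperNonsurjTower` ALSO FOLLOWS FROM KATO'S MAIN CONJECTURE 12.10 FOR `T₃E` AT ITS OWN
ROWS** (no isogeny, no Mazur–Kenku: `E[3]` irreducible gives `3 ∤ #E(ℚ)_tors`, so the kmc seat's
torsion-free descent `TorsionFree.missingPPartAt_rankZero_of_kmc` — KMC ⇒ BOTH halves of `BSD(E,3)`,
image-free — applies at `W` itself) over the readings 1♭ / 3♭ and the interface lemma `ReadsTrivialKMC`,
GZK, modularity. The KMC₃ shadow of the item, parallel to the route's lower half `WildLowerHalfRankZero`;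
KMC is the hypothesis `hK`, D-O6-2 stands, nothing is credited.
[cite: Kato2004Asterisque, Conj. 12.10 (p. 224), §14.14 and Lemma 14.15 (pp. 243–244), Prop. 14.16 (2) (p. 244)] -/
theorem wildUpperNonsurjTower_of_kmc (hR : TorsionFree.DescentCountReading IsOf)
    (hreal : TorsionFree.RealizableOfKMC IsOf KMC) (hread : ReadsTrivialKMC IsOf KMC)
    (hGZK : rank_eq_analyticRank_of_analyticRank_le_one) (hmod : hasEntireLFunction_rat)
    (hK : ∀ (W : WeierstrassCurve ℚ) [W.IsElliptic] [W.IsGloballyMinimal] [Fact (3 : ℕ).Prime],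
      W.analyticRank = 0 → ClassO6 W 3 → W.HasIrreducibleModPGaloisRep 3 →
      ¬ (∀ n : ℕ, W.HasSurjectiveModNGaloisRep (3 ^ n : ℕ)) → KMC W 3) :
    Summit.BirchSwinnertonDyer.BirchSwinnertonDyer.Theses.KatoDescentPotSupersingular.WildUpperNonsurjTower := by
  intro W _ _ _ hr hO hI hns
  have ht : ¬ 3 ∣ W.torsionOrder := Supersingular.not_dvd_torsionOrder_of_irr W 3 hI
  exact (lower_and_upper_of_missingPPartAt W 3
    (TorsionFree.missingPPartAt_rankZero_of_kmc W 3 hR hreal hread hGZK hmod hr (by decide) hO.2.1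
      hO.padicValRat_j_nonneg ht (hK W hr hO hI hns))).2

/-- **The crux `WildUpperNonsurjTower` FOLLOWS FROM IWASAWA'S `μ`-INVARIANT CONJECTURE FOR THE
3-DIVISION FIELDS `ℚ(E[3])` OF ITS ROWS** — over the image-free readings I2–I5 (Kato Thm. 12.5 (3);
12.4 (3) + 12.6 + 13.14; 14.5 (1)–(2); Coates–Sujatha Thm. 3.4 with Kato's global duality), the count 1♭,
GZK and modularity: the abstract predicate `IwMu W 3` (intended binding: the unramified Iwasawa module of
the cyclotomic `ℤ₃`-extension of `ℚ(W[3])` is finitely generated over `ℤ₃`), asked ONLY on the rows of the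
item (wild rank-`0`, `E[3]` irreducible, tower not surjective — where `ℚ(E[3])` is Galois over `ℚ` with
group `SD₁₆`, `D₄` or `GL₂(𝔽₃)`, non-abelian, so Ferrero–Washington does not apply), gives the item by
`Irreducible.missingUpperBoundAt_of_iwMu`. This is the sharpest honest form of the crux found by this seat:
a 1973 open problem of classical Iwasawa theory on a named family of number fields, with everything else
in the kernel over printed readings. Conditional; nothing asserted; the item is not closed.
[cite: CoatesSujatha2005, Conjecture A and Thm. 3.4] [cite: Kato2004Asterisque, Thm. 12.5 (3) (p. 222), Thm. 14.5 (1)–(3) (p. 236)]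
[cite: Wuthrich2014, §4 (p. 395), Lemma 14 (p. 396)] -/
theorem wildUpperNonsurjTower_of_iwMu {IwMu : ∀ (W : WeierstrassCurve ℚ) [W.IsElliptic] (p : ℕ), Prop}
    (hR : TorsionFree.DescentCountReading IsOf)
    (hdiv : Irreducible.DivisibilityOffP IsOf) (hz : Irreducible.ZetaIndexNeZero IsOf)
    (hreal : Irreducible.Realizable IsOf) (hA : Irreducible.ConjAReading IsOf IwMu)
    (hGZK : rank_eq_analyticRank_of_analyticRank_le_one) (hmod : hasEntireLFunction_rat)
    (hμ : ∀ (W : WeierstrassCurve ℚ) [W.IsElliptic] [W.IsGloballyMinimal] [Fact (3 : ℕ).Prime],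
      W.analyticRank = 0 → ClassO6 W 3 → W.HasIrreducibleModPGaloisRep 3 →
      ¬ (∀ n : ℕ, W.HasSurjectiveModNGaloisRep (3 ^ n : ℕ)) → IwMu W 3) :
    Summit.BirchSwinnertonDyer.BirchSwinnertonDyer.Theses.KatoDescentPotSupersingular.WildUpperNonsurjTower := by
  intro W _ _ _ hr hO hI hns
  exact Irreducible.missingUpperBoundAt_of_iwMu hR hdiv hz hreal hA hGZK hmod W 3 hr (by decide) hO.2.1
    hO.padicValRat_j_nonneg hI (hμ W hr hO hI hns)

end Summit.BirchSwinnertonDyer.BirchSwinnertonDyer.Theorems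

end
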